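import Literature.AlgebraicGeometry.HodgeTheory.WeilClassesFieldSubfieldDecomposable
import Literature.AlgebraicGeometry.HodgeTheory.WeilClassesFieldSplitSquareZetaEight
import Literature.AlgebraicGeometry.HodgeTheory.LefschetzOneOneHolds
import Mathlib.FieldTheory.KummerPolynomial
import HarnessLib

/-!
# Weil classes of a SUBFIELD, VI: unconditional instances of the any-index descent — `F′`-rank two with balanced
# multiplicities (Lefschetz `(1,1)`), and the subfields of Deligne's `A₀ ⊗ ℚ(ζ₈)`

Layer `Literature/AlgebraicGeometry/HodgeTheory`, theorem-only sequel of `WeilClassesFieldSubfieldSubalgebra` /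
`WeilClassesFieldSubfieldDecomposable` (Moonen–Zarhin 1998, Remark (1), for a subfield `F ⊆ F′ ⊂ End⁰(A)` of ANY
index: `W_{F′} ⊗ ℂ` algebraic ⟹ `W_F ⊗ ℂ` algebraic; `W_{F′} ⊗ ℂ ⊆ D ⊗ ℂ` ⟹ `W_F ⊗ ℂ ⊆ D ⊗ ℂ`).  THIS file records two
families of pairs `(A, F′)` for which the HYPOTHESIS on `W_{F′}` is a theorem of the tree, so that the Weil classes of
EVERY subfield `F = ℚ(S(φ)) ⊆ F′` are decomposable, resp. algebraic, with no hypothesis left.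

PRINTED STATEMENTS.  B. J. J. Moonen – Yu. G. Zarhin, *Weil classes on abelian varieties*, J. reine angew. Math. 496
(1998) 83–92 = arXiv:alg-geom/9612017 (held text `paper:arxiv-alg-geom_9612017`), Introduction (chunk p0001): «Let
`r = 2g/[F:ℚ]` … Criterion. If `n_σ = n_{σ′}` for all `σ ∈ Σ_F` then `W_F` consists entirely of Hodge classes»;
Remark (1) (chunk p0004): «if `F ⊆ F′` then … `W_{F′}` consists of decomposable Hodge classes ⟹ `W_F` consists of
decomposable Hodge classes».  B. van Geemen, LNM 1594 (1994) §2.4: «`Dᵖ` is spanned by `[D₁] ∪ … ∪ [D_p]` … In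
particular `D¹ = B¹`» (Lefschetz `(1,1)`, proved in the tree: `lefschetzOneOne_rational_holds`).  P. Deligne (notes by
J. S. Milne), LNM 900 (1982) §4, proof of Prop. 4.8 (PDF p. 50): «`A₀ ⊗_ℚ E` … is of Weil type» and Remark 4.10; the tree's
`WeilClassesFieldSplitSquareZetaEight`: for `E = ℚ(ζ₈)`, `A = A₀ ⊗ ℚ(ζ₈) = (T × T) × (T × T)` with
`Ψ(X, Y) = (Φ₁Y, X)`, `Φ₁(x, y) = (-y, x)`, the Weil classes `weilClassesField A Ψ P (2g)` are algebraic for EVERY complex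
abelian variety `T` of dimension `g ≥ 1` and every `P`.

WHAT IS PROVED (theorems only; no definition, no named fact):
* §1 (`F′`-RANK TWO) `weilClassesField_two_le_divisorClassesSpan_of_balanced` — for `P(φ) = 0`, `P` monic irreducible
  of degree `e` with `e · 2 = 2 dim A` (`[F′:ℚ] = dim A`, `r = 2`) and balanced multiplicities `n_ρ = n_ρ̄`:
  `W_{F′} ⊗ ℂ = weilClassesField A φ P 2 ⊆ D¹ ⊗ ℂ` (Moonen–Zarhin's Criterion (i): the classes are of type `(1,1)`;
  they are spanned by rational ones; a rational `(1,1)`-class is a divisor class — the Literature-side form of the route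
  lemma `Summit…weilClassesField_two_le_divisorClassesSpan`); hence, by PART V / PART IV, for EVERY subfield
  `F = ℚ(S(φ))` (`Q` monic irreducible of degree `e′`, `Q(S(φ)) = 0`, `e′ · 2m′ = 2 dim A`):
  **`weilClassesField_le_divisorClassesSpan_of_rank_two_of_eq_eval₂`** (`W_F ⊗ ℂ ⊆ D^{m′} ⊗ ℂ` — decomposable) and
  **`weilClassesField_le_algebraicClasses_of_rank_two_of_eq_eval₂`** (`W_F ⊗ ℂ` algebraic, Lefschetz `(1,1)`).
* §2 (DELIGNE'S `A₀ ⊗ ℚ(ζ₈)`) **`weilClassesField_zetaEight_subfield_le_algebraicClasses`** — for every `T` of dimension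
  `g ≥ 1`, every `S ∈ ℤ[T]` and every monic irreducible `Q` of degree `e′` with `Q(S(Ψ)) = 0` in `End A` and
  `e′ · 2m′ = 8g`: `weilClassesField A (S(Ψ)) Q (2m′) ⊆ algebraicClasses A.X m′` — the Weil classes of EVERY subfield
  `ℚ(S(ζ₈)) ⊆ ℚ(ζ₈)` on `A₀ ⊗ ℚ(ζ₈)` are algebraic (`Ψ⁴ = -𝟙`, `P = X⁴ + 1 = Φ₈` irreducible over `ℚ`,
  `4 · 2g = 2 dim A`); the three proper subfields spelled out: `weilClassesField_zetaEight_sq_le_algebraicClasses`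
  (`ℚ(i) = ℚ(ζ₈²)`: `ψ = Ψ²`, `Q = X² + 1`, degree `4g`), `weilClassesField_zetaEight_sqrtNegTwo_le_algebraicClasses`
  (`ℚ(√-2) = ℚ(ζ₈ + ζ₈³)`: `ψ = Ψ + Ψ³`, `Q = X² + 2`) and `weilClassesField_zetaEight_sqrtTwo_le_algebraicClasses` (the
  REAL quadratic field `ℚ(√2) = ℚ(ζ₈ − ζ₈³)`: `ψ = Ψ − Ψ³`, `Q = X² − 2`).

No `sorry`; axioms `propext`, `Classical.choice`, `Quot.sound`.

## References
* [MoonenZarhin1998WeilClasses] B. J. J. Moonen, Yu. G. Zarhin, *Weil classes on abelian varieties*, J. reine angew.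
  Math. 496 (1998) 83–92 = arXiv:alg-geom/9612017: Introduction (Criterion; chunk p0001), Remark (1) (chunk p0004).
* [vanGeemen1994HodgeAV] B. van Geemen, *An introduction to the Hodge conjecture for abelian varieties*, LNM 1594
  (1994), §2.4 (`D¹ = B¹`, `Dᵖ`).
* [Deligne1982HodgeCycles] P. Deligne (notes by J. S. Milne), *Hodge cycles on abelian varieties*, LNM 900 (1982), §4
  proof of Prop. 4.8 (`A₀ ⊗ E` is of Weil type), Lemma 4.5, Remark 4.10 (PDF pp. 47–50).
* [VoisinHodgeI2002] C. Voisin, *Hodge Theory and Complex Algebraic Geometry I* (2002), Thm. 11.30 (Lefschetz `(1,1)`).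
-/

noncomputable section

open CategoryTheory Polynomial

namespace Literature.AlgebraicGeometry.HodgeTheory

section HodgeTheory

open Literature.AlgebraicTopology.SingularHomology
open Literature.AlgebraicGeometry.Motives
open Literature.Barriers.HodgeConjecture (divisorClassesSpan divisorMonomials mem_divisorMonomials_one)

/-! ### §1 `F′`-rank two with balanced multiplicities: every subfield's Weil classes are decomposable -/

section RankTwo

variable {A : Motives.AbelianVariety ℂ} {φ ψ : A ⟶ A} {P S Q : Polynomial ℤ} {e e' : ℕ}

/-- **`W_{F′} ⊗ ℂ ⊆ D¹ ⊗ ℂ` in `F′`-rank two with balanced multiplicities.**  For `P(φ) = 0`, `P ∈ ℤ[T]` monic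
irreducible of degree `e`, `e · 2 = 2 dim A` (`r = 2g/[F′:ℚ] = 2`) and `n_ρ = n_ρ̄` at every root: every class of
`W_{F′} ⊗ ℂ = weilClassesField A φ P (2·1)` is of Hodge type `(1,1)` (Moonen–Zarhin's Criterion (i),
`isOfHodgeType_of_mem_weilClassesField_of_balanced`), the space is spanned by its rational classes
(`weilClassesField_eq_span_isRationalClass`), and a rational `(1,1)`-class is a divisor monomial of degree `1`
(`mem_divisorMonomials_one`; `D¹ = B¹`). (Literature-side form of the route lemma `weilClassesField_two_le_divisorClassesSpan`.)
[cite: MoonenZarhin1998WeilClasses, Introduction (Criterion; chunk p0001)] [cite: vanGeemen1994HodgeAV, §2.4] -/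
theorem weilClassesField_two_le_divisorClassesSpan_of_balanced (hPm : P.Monic) (hPe : P.natDegree = e)
    (hPirr : Irreducible (P.map (Int.castRingHom ℚ)))
    (hφ : Polynomial.eval₂ (Int.castRingHom (CategoryTheory.End A)) (φ : CategoryTheory.End A) P = 0)
    (her : e * (2 * 1) = 2 * A.dim)
    (hbal : ∀ ρ : ℂ, Polynomial.eval₂ (Int.castRingHom ℂ) ρ P = 0 →
      eigenMultiplicity A φ ρ = eigenMultiplicity A φ (starRingEnd ℂ ρ)) :
    weilClassesField A φ P (2 * 1) ≤ divisorClassesSpan A.X A.dim 1 := by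
  rw [weilClassesField_eq_span_isRationalClass hPirr hφ (2 * 1)]
  refine Submodule.span_le.2 ?_
  rintro c ⟨hcQ, hcW⟩
  have hcH : IsOfHodgeType A.dim A.X 2 1 1 c := by
    simpa using isOfHodgeType_of_mem_weilClassesField_of_balanced hPm hPe hPirr hφ her hbal hcW
  have h1 := mem_divisorMonomials_one (X := A.X) (N := A.dim) hcQ hcH
  rw [one_cupProduct] at h1
  exact Submodule.subset_span h1

/-- **`F′`-rank two, balanced ⟹ the Weil classes of EVERY subfield `F ⊆ F′` are DECOMPOSABLE.**  With `P(φ) = 0`,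
`P` monic irreducible of degree `e`, `e · 2 = 2 dim A`, balanced multiplicities, and a subfield `F = ℚ(ψ)`, `ψ = S(φ)`
(`Q(ψ) = 0`, `Q` monic irreducible of degree `e′`, `e′ · 2m′ = 2 dim A`):
`weilClassesField A ψ Q (2m′) ⊆ divisorClassesSpan A.X A.dim m′` — the `W_F`-lines are products of `[F′:F] = m′` divisor
classes (PART V `weilClassesField_le_divisorClassesSpan_of_eq_eval₂_of_irreducible` on top of the rank-two lemma).
[cite: MoonenZarhin1998WeilClasses, Remark (1) (chunk p0004)] [cite: vanGeemen1994HodgeAV, §2.4] -/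
theorem weilClassesField_le_divisorClassesSpan_of_rank_two_of_eq_eval₂ {m' : ℕ} (hPm : P.Monic)
    (hPe : P.natDegree = e) (hPirr : Irreducible (P.map (Int.castRingHom ℚ)))
    (hφ : Polynomial.eval₂ (Int.castRingHom (CategoryTheory.End A)) (φ : CategoryTheory.End A) P = 0)
    (her : e * 2 = 2 * A.dim)
    (hbal : ∀ ρ : ℂ, Polynomial.eval₂ (Int.castRingHom ℂ) ρ P = 0 →
      eigenMultiplicity A φ ρ = eigenMultiplicity A φ (starRingEnd ℂ ρ))
    (hψ : (ψ : CategoryTheory.End A) =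
      Polynomial.eval₂ (Int.castRingHom (CategoryTheory.End A)) (φ : CategoryTheory.End A) S)
    (hQm : Q.Monic) (hQe : Q.natDegree = e') (hQirr : Irreducible (Q.map (Int.castRingHom ℚ)))
    (hψQ : Polynomial.eval₂ (Int.castRingHom (CategoryTheory.End A)) (ψ : CategoryTheory.End A) Q = 0)
    (her' : e' * (2 * m') = 2 * A.dim) :
    weilClassesField A ψ Q (2 * m') ≤ divisorClassesSpan A.X A.dim m' :=
  have her₁ : e * (2 * 1) = 2 * A.dim := by rw [mul_one]; exact her
  weilClassesField_le_divisorClassesSpan_of_eq_eval₂_of_irreducible hPm hPe hPirr hφ her₁ hψ hQm hQe hQirr hψQ her'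
    (weilClassesField_two_le_divisorClassesSpan_of_balanced hPm hPe hPirr hφ her₁ hbal)

/-- **`F′`-rank two, balanced ⟹ the Weil classes of EVERY subfield `F ⊆ F′` are ALGEBRAIC** (Lefschetz `(1,1)`, the
tree's theorem `lefschetzOneOne_rational_holds`, makes the rational `(1,1)`-classes spanning `W_{F′} ⊗ ℂ` algebraic; PART
IV `weilClassesField_le_algebraicClasses_of_eq_eval₂_of_irreducible` descends).
[cite: MoonenZarhin1998WeilClasses, Remark (1) (chunk p0004)] [cite: VoisinHodgeI2002, Thm. 11.30] -/
theorem weilClassesField_le_algebraicClasses_of_rank_two_of_eq_eval₂ {m' : ℕ} (hPm : P.Monic)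
    (hPe : P.natDegree = e) (hPirr : Irreducible (P.map (Int.castRingHom ℚ)))
    (hφ : Polynomial.eval₂ (Int.castRingHom (CategoryTheory.End A)) (φ : CategoryTheory.End A) P = 0)
    (her : e * 2 = 2 * A.dim)
    (hbal : ∀ ρ : ℂ, Polynomial.eval₂ (Int.castRingHom ℂ) ρ P = 0 →
      eigenMultiplicity A φ ρ = eigenMultiplicity A φ (starRingEnd ℂ ρ))
    (hψ : (ψ : CategoryTheory.End A) =
      Polynomial.eval₂ (Int.castRingHom (CategoryTheory.End A)) (φ : CategoryTheory.End A) S)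
    (hQm : Q.Monic) (hQe : Q.natDegree = e') (hQirr : Irreducible (Q.map (Int.castRingHom ℚ)))
    (hψQ : Polynomial.eval₂ (Int.castRingHom (CategoryTheory.End A)) (ψ : CategoryTheory.End A) Q = 0)
    (her' : e' * (2 * m') = 2 * A.dim) :
    weilClassesField A ψ Q (2 * m') ≤ algebraicClasses A.X m' := by
  have her₁ : e * (2 * 1) = 2 * A.dim := by rw [mul_one]; exact her
  have hX : IsSmoothProjective A.dim A.X := Motives.AbelianVariety.isSmoothProjective_holds (A := A)
  have hW : weilClassesField A φ P (2 * 1) ≤ algebraicClasses A.X 1 := by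
    rw [weilClassesField_eq_span_isRationalClass hPirr hφ (2 * 1)]
    refine Submodule.span_le.2 ?_
    rintro c ⟨hcQ, hcW⟩
    exact lefschetzOneOne_rational_holds hX c hcQ
      (isOfHodgeType_of_mem_weilClassesField_of_balanced hPm hPe hPirr hφ her₁ hbal hcW)
  exact weilClassesField_le_algebraicClasses_of_eq_eval₂_of_irreducible hPm hPe hPirr hφ her₁ hψ hQm hQe hQirr hψQ
    her' hW

end RankTwo

/-! ### §2 Deligne's `A₀ ⊗ ℚ(ζ₈)`: the Weil classes of every subfield `ℚ(S(ζ₈))` are algebraic -/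

section ZetaEight

variable {T : Motives.AbelianVariety ℂ} {g : ℕ}

/-- **The Weil classes of EVERY subfield of `ℚ(ζ₈)` on Deligne's `A = A₀ ⊗ ℚ(ζ₈) = (T × T) × (T × T)` are
algebraic.**  For every complex abelian variety `T` of dimension `g ≥ 1`, `Ψ(X, Y) = (Φ₁Y, X)`, `Φ₁(x,y) = (-y,x)`
(`Ψ⁴ = -𝟙`, `F′ = ℚ(Ψ) = ℚ(ζ₈)`, `P = X⁴ + 1 = Φ₈` monic irreducible over `ℚ`, `4 · 2g = 2 dim A`), every
`S ∈ ℤ[T]`, every `ψ` with `ψ = S(Ψ)` in `End A` and every monic irreducible `Q ∈ ℤ[T]` of degree `e′` with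
`Q(ψ) = 0` and `e′ · 2m′ = 8g`: `weilClassesField A ψ Q (2m′) ⊆ algebraicClasses A.X m′` — `W_{ℚ(ζ₈)} ⊗ ℂ` is
algebraic for every `T` (`weilClassesField_zetaEight_le_algebraicClasses`, Deligne's Lemma 4.5 / Remark 4.10 on the
carriers) and algebraicity descends to every subfield (PART IV).
[cite: Deligne1982HodgeCycles, §4 proof of Prop. 4.8, Lemma 4.5, Remark 4.10 (PDF pp. 47–50)]
[cite: MoonenZarhin1998WeilClasses, Remark (1) (chunk p0004)] -/
theorem weilClassesField_zetaEight_subfield_le_algebraicClasses (hg : 0 < g) (hT : T.dim = g)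
    {S Q : Polynomial ℤ} {e' m' : ℕ} (hQm : Q.Monic) (hQe : Q.natDegree = e')
    (hQirr : Irreducible (Q.map (Int.castRingHom ℚ))) (her' : e' * (2 * m') = 8 * g) :
    let T₂ := T.prod T
    let Φ₁ : T₂ ⟶ T₂ := AbelianVariety.prodLift (AbelianVariety.snd T T ≫ (-(𝟙 T))) (AbelianVariety.fst T T)
    let Ψ : T₂.prod T₂ ⟶ T₂.prod T₂ :=
      AbelianVariety.prodLift (AbelianVariety.snd T₂ T₂ ≫ Φ₁) (AbelianVariety.fst T₂ T₂)
    let A := T₂.prod T₂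
    ∀ ψ : A ⟶ A, (ψ : CategoryTheory.End A) =
        Polynomial.eval₂ (Int.castRingHom (CategoryTheory.End A)) (Ψ : CategoryTheory.End A) S →
      Polynomial.eval₂ (Int.castRingHom (CategoryTheory.End A)) (ψ : CategoryTheory.End A) Q = 0 →
      weilClassesField A ψ Q (2 * m') ≤ algebraicClasses A.X m' := by
  intro T₂ Φ₁ Ψ A ψ hψ hψQ
  have hT₂ : T₂.dim = g + g := by
    show (T.prod T).dim = g + g
    rw [AbelianVariety.dim_prod, hT]
  have hdim : A.dim = 4 * g := by
    show (T₂.prod T₂).dim = 4 * g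
    rw [AbelianVariety.dim_prod, hT₂]
    ring
  -- `P = X⁴ + 1 = Φ₈`
  have hPm : (X ^ 4 + 1 : Polynomial ℤ).Monic := by
    simpa using Polynomial.monic_X_pow_add_C (1 : ℤ) (n := 4) (by norm_num)
  have hPe : (X ^ 4 + 1 : Polynomial ℤ).natDegree = 4 := by
    simpa using Polynomial.natDegree_X_pow_add_C (n := 4) (r := (1 : ℤ))
  have hPirr : Irreducible ((X ^ 4 + 1 : Polynomial ℤ).map (Int.castRingHom ℚ)) := by
    have h8 : Polynomial.cyclotomic 8 ℚ = X ^ 4 + 1 := by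
      rw [show (8 : ℕ) = 2 ^ (2 + 1) by norm_num, Polynomial.cyclotomic_prime_pow_eq_geom_sum Nat.prime_two]
      simp [Finset.sum_range_succ]
      ring
    have hmap : (X ^ 4 + 1 : Polynomial ℤ).map (Int.castRingHom ℚ) = X ^ 4 + 1 := by
      simp [Polynomial.map_add, Polynomial.map_pow]
    rw [hmap, ← h8]
    exact Polynomial.cyclotomic.irreducible_rat (by norm_num)
  -- `P(Ψ) = Ψ⁴ + 1 = 0` in `End A`
  have hΨ : Polynomial.eval₂ (Int.castRingHom (CategoryTheory.End A)) (Ψ : CategoryTheory.End A)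
      (X ^ 4 + 1 : Polynomial ℤ) = 0 := by
    have h4 : Ψ ≫ Ψ ≫ Ψ ≫ Ψ = -(𝟙 A) := zetaEight_pow_four T
    rw [Polynomial.eval₂_add, Polynomial.eval₂_X_pow, Polynomial.eval₂_one]
    simp only [pow_succ, pow_zero, one_mul, End.mul_def]
    rw [h4]
    exact neg_add_cancel (1 : CategoryTheory.End A)
  have her : 4 * (2 * g) = 2 * A.dim := by rw [hdim]; ring
  have her'' : e' * (2 * m') = 2 * A.dim := by rw [hdim, her']; ring
  exact weilClassesField_le_algebraicClasses_of_eq_eval₂_of_irreducible hPm hPe hPirr hΨ her hψ hQm hQe hQirr hψQ her''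
    (weilClassesField_zetaEight_le_algebraicClasses hg hT (X ^ 4 + 1))

/-- `Q(ψ) = 0` in `End A` from a polynomial identity `Q ∘ S = (X⁴ + 1) · R` and `Ψ⁴ = -𝟙`, `ψ = S(Ψ)`. [folklore] -/
private theorem eval₂_eq_zero_of_comp_eq_mul {A : Motives.AbelianVariety ℂ} {Ψ ψ : A ⟶ A} {S Q R : Polynomial ℤ}
    (hΨ : Polynomial.eval₂ (Int.castRingHom (CategoryTheory.End A)) (Ψ : CategoryTheory.End A)
      (X ^ 4 + 1 : Polynomial ℤ) = 0)
    (hψ : (ψ : CategoryTheory.End A) =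
      Polynomial.eval₂ (Int.castRingHom (CategoryTheory.End A)) (Ψ : CategoryTheory.End A) S)
    (hQS : Q.comp S = (X ^ 4 + 1) * R) :
    Polynomial.eval₂ (Int.castRingHom (CategoryTheory.End A)) (ψ : CategoryTheory.End A) Q = 0 := by
  have hint : Int.castRingHom (CategoryTheory.End A) = algebraMap ℤ (CategoryTheory.End A) := RingHom.ext_int _ _
  rw [hint, ← Polynomial.aeval_def] at hΨ hψ ⊢
  rw [hψ, ← Polynomial.aeval_comp, hQS, map_mul, hΨ, zero_mul]

/-- **`ℚ(i) = ℚ(ζ₈²) ⊂ ℚ(ζ₈)`**: on Deligne's `A = (T × T) × (T × T)` the Weil classes of `ψ = Ψ²` (`ψ² = -𝟙`,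
`Q = X² + 1`, degree `4g = 2 · 2g`) are algebraic, for every `T` of dimension `g ≥ 1`.
[cite: Deligne1982HodgeCycles, §4 Lemma 4.5 and Remark 4.10] [cite: MoonenZarhin1998WeilClasses, Remark (1) (chunk p0004)] -/
theorem weilClassesField_zetaEight_sq_le_algebraicClasses (hg : 0 < g) (hT : T.dim = g) :
    let T₂ := T.prod T
    let Φ₁ : T₂ ⟶ T₂ := AbelianVariety.prodLift (AbelianVariety.snd T T ≫ (-(𝟙 T))) (AbelianVariety.fst T T)
    let Ψ : T₂.prod T₂ ⟶ T₂.prod T₂ :=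
      AbelianVariety.prodLift (AbelianVariety.snd T₂ T₂ ≫ Φ₁) (AbelianVariety.fst T₂ T₂)
    let A := T₂.prod T₂
    weilClassesField A (Ψ ≫ Ψ) (X ^ 2 + 1 : Polynomial ℤ) (2 * (2 * g)) ≤ algebraicClasses A.X (2 * g) := by
  intro T₂ Φ₁ Ψ A
  have hQm : (X ^ 2 + 1 : Polynomial ℤ).Monic := by
    simpa using Polynomial.monic_X_pow_add_C (1 : ℤ) (n := 2) (by norm_num)
  have hQe : (X ^ 2 + 1 : Polynomial ℤ).natDegree = 2 := by
    simpa using Polynomial.natDegree_X_pow_add_C (n := 2) (r := (1 : ℤ))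
  have hQirr : Irreducible ((X ^ 2 + 1 : Polynomial ℤ).map (Int.castRingHom ℚ)) := by
    have hirr : Irreducible (X ^ 2 + C (1 : ℚ) : ℚ[X]) := by
      have hp : (X ^ 2 + C (1 : ℚ) : ℚ[X]).Monic := monic_X_pow_add_C _ two_ne_zero
      have hdeg : (X ^ 2 + C (1 : ℚ) : ℚ[X]).natDegree = 2 := natDegree_X_pow_add_C
      refine (hp.irreducible_iff_roots_eq_zero_of_degree_le_three (by omega) (by omega)).2 ?_
      refine Multiset.eq_zero_of_forall_notMem fun r hr => ?_
      rw [mem_roots hp.ne_zero, IsRoot, eval_add, eval_pow, eval_X, eval_C] at hr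
      nlinarith [sq_nonneg r]
    have hmap : (X ^ 2 + 1 : Polynomial ℤ).map (Int.castRingHom ℚ) = X ^ 2 + C 1 := by
      rw [Polynomial.map_add, Polynomial.map_pow, Polynomial.map_X, Polynomial.map_one, map_one]
    rw [hmap]
    exact hirr
  have hψ : ((Ψ ≫ Ψ : A ⟶ A) : CategoryTheory.End A) =
      Polynomial.eval₂ (Int.castRingHom (CategoryTheory.End A)) (Ψ : CategoryTheory.End A) (X ^ 2) := by
    rw [Polynomial.eval₂_X_pow, pow_two, End.mul_def]
  refine weilClassesField_zetaEight_subfield_le_algebraicClasses hg hT hQm hQe hQirr (by ring) (Ψ ≫ Ψ) hψ ?_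
  -- `Q(ψ) = Ψ⁴ + 1 = 0`: `(X² + 1) ∘ X² = X⁴ + 1`
  have hΨ : Polynomial.eval₂ (Int.castRingHom (CategoryTheory.End A)) (Ψ : CategoryTheory.End A)
      (X ^ 4 + 1 : Polynomial ℤ) = 0 := by
    have h4 : Ψ ≫ Ψ ≫ Ψ ≫ Ψ = -(𝟙 A) := zetaEight_pow_four T
    rw [Polynomial.eval₂_add, Polynomial.eval₂_X_pow, Polynomial.eval₂_one]
    simp only [pow_succ, pow_zero, one_mul, End.mul_def]
    rw [h4]
    exact neg_add_cancel (1 : CategoryTheory.End A)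
  exact eval₂_eq_zero_of_comp_eq_mul (R := 1) hΨ hψ (by simp [Polynomial.add_comp]; ring)

/-- **`ℚ(√-2) = ℚ(ζ₈ + ζ₈³) ⊂ ℚ(ζ₈)`**: on Deligne's `A = (T × T) × (T × T)` the Weil classes of `ψ = Ψ + Ψ³`
(`ψ² = -2`, `Q = X² + 2`, degree `4g`) are algebraic, for every `T` of dimension `g ≥ 1`.
[cite: Deligne1982HodgeCycles, §4 Lemma 4.5 and Remark 4.10] [cite: MoonenZarhin1998WeilClasses, Remark (1) (chunk p0004)] -/
theorem weilClassesField_zetaEight_sqrtNegTwo_le_algebraicClasses (hg : 0 < g) (hT : T.dim = g) :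
    let T₂ := T.prod T
    let Φ₁ : T₂ ⟶ T₂ := AbelianVariety.prodLift (AbelianVariety.snd T T ≫ (-(𝟙 T))) (AbelianVariety.fst T T)
    let Ψ : T₂.prod T₂ ⟶ T₂.prod T₂ :=
      AbelianVariety.prodLift (AbelianVariety.snd T₂ T₂ ≫ Φ₁) (AbelianVariety.fst T₂ T₂)
    let A := T₂.prod T₂
    weilClassesField A (Ψ + Ψ ≫ Ψ ≫ Ψ) (X ^ 2 + 2 : Polynomial ℤ) (2 * (2 * g)) ≤ algebraicClasses A.X (2 * g) := by
  intro T₂ Φ₁ Ψ A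
  have hQm : (X ^ 2 + 2 : Polynomial ℤ).Monic := by
    simpa using Polynomial.monic_X_pow_add_C (2 : ℤ) (n := 2) (by norm_num)
  have hQe : (X ^ 2 + 2 : Polynomial ℤ).natDegree = 2 := by
    simpa using Polynomial.natDegree_X_pow_add_C (n := 2) (r := (2 : ℤ))
  have hQirr : Irreducible ((X ^ 2 + 2 : Polynomial ℤ).map (Int.castRingHom ℚ)) := by
    have hirr : Irreducible (X ^ 2 + C (2 : ℚ) : ℚ[X]) := by
      have hp : (X ^ 2 + C (2 : ℚ) : ℚ[X]).Monic := monic_X_pow_add_C _ two_ne_zero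
      have hdeg : (X ^ 2 + C (2 : ℚ) : ℚ[X]).natDegree = 2 := natDegree_X_pow_add_C
      refine (hp.irreducible_iff_roots_eq_zero_of_degree_le_three (by omega) (by omega)).2 ?_
      refine Multiset.eq_zero_of_forall_notMem fun r hr => ?_
      rw [mem_roots hp.ne_zero, IsRoot, eval_add, eval_pow, eval_X, eval_C] at hr
      nlinarith [sq_nonneg r]
    have hmap : (X ^ 2 + 2 : Polynomial ℤ).map (Int.castRingHom ℚ) = X ^ 2 + C 2 := by
      rw [show (X ^ 2 + 2 : Polynomial ℤ) = X ^ 2 + C 2 by rw [map_ofNat], Polynomial.map_add,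
        Polynomial.map_pow, Polynomial.map_X, Polynomial.map_C, map_ofNat, map_ofNat]
    rw [hmap]
    exact hirr
  have hψ : ((Ψ + Ψ ≫ Ψ ≫ Ψ : A ⟶ A) : CategoryTheory.End A) =
      Polynomial.eval₂ (Int.castRingHom (CategoryTheory.End A)) (Ψ : CategoryTheory.End A) (X + X ^ 3) := by
    rw [Polynomial.eval₂_add, Polynomial.eval₂_X, Polynomial.eval₂_X_pow]
    simp only [pow_succ, pow_zero, one_mul, End.mul_def]
    rfl
  refine weilClassesField_zetaEight_subfield_le_algebraicClasses hg hT hQm hQe hQirr (by ring) (Ψ + Ψ ≫ Ψ ≫ Ψ) hψ ?_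
  have hΨ : Polynomial.eval₂ (Int.castRingHom (CategoryTheory.End A)) (Ψ : CategoryTheory.End A)
      (X ^ 4 + 1 : Polynomial ℤ) = 0 := by
    have h4 : Ψ ≫ Ψ ≫ Ψ ≫ Ψ = -(𝟙 A) := zetaEight_pow_four T
    rw [Polynomial.eval₂_add, Polynomial.eval₂_X_pow, Polynomial.eval₂_one]
    simp only [pow_succ, pow_zero, one_mul, End.mul_def]
    rw [h4]
    exact neg_add_cancel (1 : CategoryTheory.End A)
  -- `(X + X³)² + 2 = X⁶ + 2X⁴ + X² + 2 = (X⁴ + 1)(X² + 2)`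
  exact eval₂_eq_zero_of_comp_eq_mul (R := X ^ 2 + 2) hΨ hψ (by simp [Polynomial.add_comp]; ring)

/-- **The REAL quadratic field `ℚ(√2) = ℚ(ζ₈ − ζ₈³) ⊂ ℚ(ζ₈)`**: on Deligne's `A = (T × T) × (T × T)` the Weil
classes of `ψ = Ψ − Ψ³` (`ψ² = 2`, `Q = X² − 2`, degree `4g`; for a totally real field the multiplicities are
trivially balanced, `σ̄ = σ`) are algebraic, for every `T` of dimension `g ≥ 1`.
[cite: Deligne1982HodgeCycles, §4 Lemma 4.5 and Remark 4.10] [cite: MoonenZarhin1998WeilClasses, Remark (1) (chunk p0004)] -/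
theorem weilClassesField_zetaEight_sqrtTwo_le_algebraicClasses (hg : 0 < g) (hT : T.dim = g) :
    let T₂ := T.prod T
    let Φ₁ : T₂ ⟶ T₂ := AbelianVariety.prodLift (AbelianVariety.snd T T ≫ (-(𝟙 T))) (AbelianVariety.fst T T)
    let Ψ : T₂.prod T₂ ⟶ T₂.prod T₂ :=
      AbelianVariety.prodLift (AbelianVariety.snd T₂ T₂ ≫ Φ₁) (AbelianVariety.fst T₂ T₂)
    let A := T₂.prod T₂
    weilClassesField A (Ψ - Ψ ≫ Ψ ≫ Ψ) (X ^ 2 - 2 : Polynomial ℤ) (2 * (2 * g)) ≤ algebraicClasses A.X (2 * g) := by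
  intro T₂ Φ₁ Ψ A
  have hQm : (X ^ 2 - 2 : Polynomial ℤ).Monic := by
    simpa using Polynomial.monic_X_pow_sub_C (2 : ℤ) (n := 2) (by norm_num)
  have hQe : (X ^ 2 - 2 : Polynomial ℤ).natDegree = 2 := by
    simpa using Polynomial.natDegree_X_pow_sub_C (n := 2) (r := (2 : ℤ))
  have hQirr : Irreducible ((X ^ 2 - 2 : Polynomial ℤ).map (Int.castRingHom ℚ)) := by
    have hirr : Irreducible (X ^ 2 - C (2 : ℚ) : ℚ[X]) := by
      refine (X_pow_sub_C_irreducible_iff_of_prime Nat.prime_two).mpr fun b hb => ?_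
      have hreal : ((|b| : ℚ) : ℝ) = Real.sqrt 2 := by
        rw [Rat.cast_abs, ← Real.sqrt_sq_eq_abs, ← Rat.cast_pow, hb, Rat.cast_ofNat]
      exact irrational_sqrt_two.ne_rat |b| hreal.symm
    have hmap : (X ^ 2 - 2 : Polynomial ℤ).map (Int.castRingHom ℚ) = X ^ 2 - C 2 := by
      rw [show (X ^ 2 - 2 : Polynomial ℤ) = X ^ 2 - C 2 by rw [map_ofNat], Polynomial.map_sub,
        Polynomial.map_pow, Polynomial.map_X, Polynomial.map_C, map_ofNat, map_ofNat]
    rw [hmap]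
    exact hirr
  have hψ : ((Ψ - Ψ ≫ Ψ ≫ Ψ : A ⟶ A) : CategoryTheory.End A) =
      Polynomial.eval₂ (Int.castRingHom (CategoryTheory.End A)) (Ψ : CategoryTheory.End A) (X - X ^ 3) := by
    rw [Polynomial.eval₂_sub, Polynomial.eval₂_X, Polynomial.eval₂_X_pow]
    simp only [pow_succ, pow_zero, one_mul, End.mul_def]
    rfl
  refine weilClassesField_zetaEight_subfield_le_algebraicClasses hg hT hQm hQe hQirr (by ring) (Ψ - Ψ ≫ Ψ ≫ Ψ) hψ ?_
  have hΨ : Polynomial.eval₂ (Int.castRingHom (CategoryTheory.End A)) (Ψ : CategoryTheory.End A)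
      (X ^ 4 + 1 : Polynomial ℤ) = 0 := by
    have h4 : Ψ ≫ Ψ ≫ Ψ ≫ Ψ = -(𝟙 A) := zetaEight_pow_four T
    rw [Polynomial.eval₂_add, Polynomial.eval₂_X_pow, Polynomial.eval₂_one]
    simp only [pow_succ, pow_zero, one_mul, End.mul_def]
    rw [h4]
    exact neg_add_cancel (1 : CategoryTheory.End A)
  -- `(X − X³)² − 2 = X⁶ − 2X⁴ + X² − 2 = (X⁴ + 1)(X² − 2)`
  exact eval₂_eq_zero_of_comp_eq_mul (R := X ^ 2 - 2) hΨ hψ (by simp [Polynomial.sub_comp]; ring)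

end ZetaEight

end HodgeTheory

end Literature.AlgebraicGeometry.HodgeTheory
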